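import Summits.BirchSwinnertonDyer.Rank1Residual.X4.KolyvaginSqueeze
import Summits.BirchSwinnertonDyer.Rank1Residual.Additive.SharpenedStatements
import HarnessLib
import HarnessLib.Audit.Tags

/-!
# O5 — the non-Iwasawa target at a tame potentially-supersingular additive `3`:
# "Gross's Conjecture 1.2, `3`-adically" (BSD₃ over `K` for every Heegner pair), TYPED
# (cell `b2b-bsdres`, team o5o6, seat O5 planner 2; STATEMENTS ONLY — three conjectures, two
# bookkeeping theorems; nothing asserted, nothing booked, no label changes)

HONEST FRAMING (cell `b2b-bsdres`, run/shared/lean/b2b/bsd-rank1-residual/, verbatim in every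
file): the goal of the cell is to DELETE the COMBINATION-SHAPED residual classes of the
Birch–Swinnerton-Dyer formula for ALL analytic-rank `≤ 1` elliptic curves over `ℚ`, assembled
STRICTLY from published theorems, so that the rank-`≤ 1` remainder becomes exactly the
CONSTRUCTION-SHAPED classes, which are TYPED (missing-input `Prop`s), NOT attempted. Prove what is
provable now; shrink each hard class to its core with data; no claim beyond stated classes.
Research routes; census output = EVIDENCE / conjecture items, never a Literature fact. Every
declaration below is a `def … : Prop` tagged `@[conjecture]` or a one-line bookkeeping theorem.

## The cell and what is missing (RESIDUAL-MAP §I O5, S-b @3: X4 40 788 (r0 39 029 / r1 1 759), X3 5 279)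

O5 = (X3 ∪ X4) ∧ additive `3` ∧ `v₃(N) = 2` (tame) ∧ potentially good SUPERSINGULAR — census cells
(t′) (`Additive.SubTprime W 3`: `e = 4`, Kodaira III/III*) and the supersingular share of (G) with
`e = 2` (quadratic twists by a character ramified at `3` of a good supersingular curve). In the
kernel at `3`: the rank-`0` UPPER half `ord₃ #Ш ≤ ord₃ #Ш_an` on X4 ∧ `r = 0` ∧ tower-surjective ∧
`3 ∤ ∏ c_ℓ · c_D` rows (Kato 2004 Thm. 14.5 (3), `X4RankZero.missingUpperBoundAt_of_kato`, file
`Additive/X4RankZeroKatoBound.lean`). Missing at class level: the rank-`0` LOWER half (no signed /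
chromatic Selmer condition, `3`-adic `L`-function or main conjecture is formulated in print at a
potentially supersingular ADDITIVE prime — team O5 planner 1) and BOTH halves in rank `1`.

## What this file types (planner 2: the non-Iwasawa side)

The Heegner–Kolyvagin mechanism does not read the reduction type of `E` at `p`: Kolyvagin's bound
(McCallum 1991 §1, tree fact `Kolyvagin1990_padicValNat_card_sha_le`) and Kolyvagin's STRUCTURE
THEOREM for `Ш(E/K)[p^∞]` in terms of the divisibility orders `M_0 ≥ M_1 ≥ … ≥ M_∞` of the derived
Heegner points (McCallum 1991 Thm. 5.4 / Cor. 5.5–5.6 / Thm. 5.8, printed for "`p` odd,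
`Gal(ℚ(E_p)/ℚ) ≅ GL₂(ℤ/p)`", NO `p ∤ N`; W. Zhang, Camb. J. Math. 2 (2014) Thm. 4.7 / CDM 2013
Thm. 4.7 add `p ∤ ND` "for convenience") hold at an additive `p = 3`. What they leave open is ONE
number per Heegner pair: `M_∞`. Kolyvagin conjectured `M_∞ < ∞` (proved by Zhang 2014 Thm. 1.1 at a
good ORDINARY `p ≥ 5`; Burungale–Castella–Grossi–Skinner arXiv:2312.09301 Thm. 2 at good `p > 3`);
the REFINED conjecture (Zhang CDM 2013 Conj. 4.5: `M_∞ = ord_p(c_E · ∏_{q∣N} c_q)`) is, by Cor. 5.6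
(`ord_p #Ш(E/K) = 2(M_0 − M_∞)`) and Gross–Zagier, EQUIVALENT to the `p`-part of Gross's
Conjecture 1.2 = BSD over `K` for the pair:

  `#Ш(E/K) = ([E(K) : ℤ y_K] / (c · ∏_{q∣N} c_q))²`  (Gross 1991 Conj. 1.2 = Gross–Zagier V.(2.2)).

So the non-Iwasawa TARGET for O5 is typed in the census currency as the per-pair predicate
`HeegnerIndexBSDAt W p` (§1) — the `p`-adic valuation of that display, with the parametrisation
datum `D` (its Manin constant `c_D`) explicit and the Tamagawa product of `E/ℚ` squared (Heegner
hypothesis: every `q ∣ N` splits in `K`, every `q ∣ d_K` is good, so `∏_v c_v(E/K) = (∏_q c_q)²`) —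
and the class conjectures `O5HeegnerIndexThree` (tame potentially good additive `3` ⊇ O5; the
mechanism cannot see ordinary vs supersingular, so the (G-ord) `e = 2` rows ride along) and
`O6HeegnerIndexThree` (the wild sibling, `v₃(N) ≥ 3`, for team O6) (§2), both under `3`-adic TOWER
surjectivity (`∀ n, ρ̄_{E,3^n}` onto: the binder under which Kolyvagin's derivative classes, Kato's
(12.5.2) and the census certificate SURJ9 all live; surj(3) alone does not give it — Elkies).

## Why this is the right-shaped target (the transport law; EVIDENCE labels, nothing asserted)

For a Heegner pair `(E, K)` at `p = 3` write `{E, E^K} = {E₀ (rank 0), E₁ (rank 1)}`,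
`a = ½ ord₃ #Ш_an(E₀)`, `b = ½ ord₃ #Ш_an(E₁)`, `k = ord₃ [E(K) : ℤ y_K]`, `t = ord₃ ∏_q c_q(E)`,
`m = ord₃ c_D`. Gross–Zagier in the census currency gives `k = a + b + t + m` (STEP-0 bookkeeping,
checked per pair by the census engine `koly3.gp`; content at `9 ∣ N`: `3 ∤ c_D`, discharged for
optimal curves of conductor `≤ 130000` by Cremona (tree fact
`AgasheRibetStein2006.cremona_abs_maninConstant_eq_one_of_level_le`) and in general by
Česnavičius–Neururer–Saha arXiv:1911.09446 Thm. 1.2: `v₃(c) ≤ v₃(deg φ)` at `v₃(N) = 2`).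
`HeegnerIndexBSDAt E 3` at the pair says `ord₃ #Ш(E₀) + ord₃ #Ш(E₁) = 2a + 2b` (odd-part splitting
`#Ш(E/K)[3^∞] = #Ш(E₀)[3^∞] · #Ш(E₁)[3^∞]`, tree theorem
`card_primaryComponent_sha_baseChange_quadratic_of_odd_of_finite`). Hence, on tower-surjective
Tamagawa-clean rows: (i) with Kato's rank-`0` UPPER half (kernel) it yields the rank-`1` LOWER half
`ord₃ #Ш(E₁) ≥ ord₃ #Ш_an(E₁)` CLASS-LEVEL; (ii) with ANY rank-`0` LOWER-half theorem for `E₀`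
(team O5 planner 1's Iwasawa-side target T-O5-A) it yields `BSD(E₁, 3)` — the rank-`1` cells of O5
need NO separate rank-`1` object: T-O5-A (rank `0`, curves only) + this target + Kato close O5♯ :=
O5 ∧ X4 ∧ tower-surjective in BOTH ranks, exactly as Skinner–Urban + Kato + Kolyvagin-exactness close
the good ordinary case (Zhang 2014 Thm. 1.3; Jetchev–Skinner–Wan 2017 §7.4). (iii) The proof route
to this target itself (Zhang's induction on `M_r`) needs the rank-`0` lower half for LEVEL-RAISED
weight-`2` newforms of level `9M·ℓ(ℓ′)` congruent to `f_E` mod `3` (same local type at `3`): the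
convergence request to planner 1 is to state T-O5-A for newforms, not only for elliptic curves.

## Census tests (CLASS-CLOSURE-PLAN §3 E1; team file cells/o5o6/TARGETS.md §T-O5-B)

(C1) STEP-0 on every O5 Heegner pair the census holds (`koly3.gp` exact index): `k = a + b + t + m`
with `m = 0` — a failure is a Manin-constant event (`3 ∣ c_D` at `9 ∣ N`) or an engine bug, logged
either way; list the O5 curves with `N > 130000 ∧ 3 ∣ deg φ` (the only rows where `m` is not
discharged in print). (C2) CONSISTENCY: on every O5♯ pair with BOTH members decided per pair
(window: all (t′)@3 rows are bucket A by DESC-SA / HEEGIDX / KOLY-SQ3), `HeegnerIndexBSDAt` holds —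
automatic from BSD₃ of both members; a violation refutes BSD₃ itself. (C3) THE DIRECT TEST
(engine request KOLY-DERIV1@3): for pairs with `k ≥ 1`, certify `M_1 = 0` by exhibiting a Kolyvagin
prime `ℓ` (`ℓ ∤ 3ND_K` inert, `a_ℓ ≡ ℓ + 1 ≡ 0 mod 3`) whose derived point `P_ℓ ∈ E(K_ℓ)` is not
`3`-divisible (reduction of `P_ℓ` modulo a prime of `K_ℓ` above an auxiliary inert prime, via
supersingular points / the Brandt module — Stein's method, Jetchev–Lauter–Stein arXiv:0707.0032 §3);
by Thm. 5.8 `M_1 = 0` forces `Ш(E₀)[3^∞] ≅ (ℤ/3^k)²` and `Ш(E₁)[3^∞] = 0`, so the target PREDICTS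
that the certificate fires iff `b + t + m = 0`; ONE pair with `3 ∣ #Ш_an(E₁)` (or `3 ∣ ∏ c_q`) on
which it fires REFUTES the target (or BSD₃, or the structure-theorem reading at `3 ∣ N`) — a
two-sided, per-pair-decidable falsifier that no descent instrument provides.

References: B. H. Gross, *Kolyvagin's work on modular elliptic curves*, LMS LN 153 (1991) Conj. 1.2,
Thm. 1.3, Prop. 2.1 [GrossLMS1991]; W. G. McCallum, *Kolyvagin's work on Shafarevich–Tate groups*,
ibid. §1, Thm. 5.4, Cor. 5.5–5.6, Prop. 5.7, Thm. 5.8 [McCallumLMS1991]; V. A. Kolyvagin, *Euler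
systems* (1990) [KolyvaginEulerSystems1990] and *On the structure of Shafarevich–Tate groups*
(Springer LNM 1479, 1991); W. Zhang, Camb. J. Math. 2 (2014) 191–253, Thm. 1.1–1.3, 4.7, 10.2, 11.2;
W. Zhang, Current Developments in Math. 2013, Conj. 4.3, 4.5, Thm. 4.6–4.7; A. Burungale,
F. Castella, G. Grossi, C. Skinner, arXiv:2312.09301 Thm. 1–2; D. Jetchev, Compos. Math. 144 (2008)
Cor. 1.5 [Jetchev2008]; D. Jetchev, K. Lauter, W. Stein, arXiv:0707.0032 §3; B. Gross, D. Zagier,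
Invent. Math. 84 (1986) V.(2.2) [GrossZagier1986]; K. Česnavičius, M. Neururer, A. Saha,
arXiv:1911.09446 Thm. 1.2; A. Agashe, K. Ribet, W. Stein, *The Manin constant* (2006)
[AgasheRibetStein2006]; K. Kato, Astérisque 295 (2004) Thm. 14.5, (12.5.2) [Kato2004Asterisque];
A. Matar, J. Nekovář, Acta Arith. 189 (2019) [MatarNekovar2019]; Miller 2011 Def. 1.1 [Miller2011LMS].
-/

noncomputable section

open scoped Classical

open WeierstrassCurve Literature.NumberTheory.EllipticCurves
  Literature.NumberTheory.EllipticCurves.ModularForms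
  Literature.NumberTheory.EllipticCurves.Rank1Residual
  Literature.NumberTheory.EllipticCurves.Rank1Residual.Typed

namespace Summit.BirchSwinnertonDyer.Rank1Residual.O5

/-! ## §1 The per-pair predicate: Gross's Conjecture 1.2, `p`-adically, datum-explicit -/

/-- **`HeegnerIndexBSDAt W p` — the `p`-part of Gross's Conjecture 1.2 (= BSD over `K`) for EVERY
Heegner pair of `W`**, in the census currency: for an odd `p` with `ρ̄_{E,p}` onto (so `E(K)[p] = 0`
and the identity below is insensitive to torsion), every parametrisation datum `D` of `W` at level
`N` (so `N = N_E`), every imaginary quadratic `K` of discriminant `< -4` (units `±1`) with the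
Heegner hypothesis for `N`, every `P ∈ E(K)` mapping to the Heegner point `Tr_{H_K/K} φ_D(τ)` of `D`,
of infinite order:
`ord_p #Ш(E/K)[p^∞] + 2·ord_p ∏_q c_q(E/ℚ) + 2·ord_p c_D = 2·ord_p [E(K) : ℤ P]`.
Junk values: if `Ш(E/K)[p^∞]` were infinite `Nat.card = 0` and if the index were infinite
`index = 0`, both of valuation `0` — but `P` of infinite order makes both finite (Kolyvagin, tree
fact `kolyvagin`), so no junk case is asserted vacuously true or false by accident. A predicate on
`(W, p)`; nothing asserted; OPEN at every `p` for pairs with `p ∣ [E(K) : ℤ P]` beyond the good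
ordinary range of Zhang 2014 Thm. 1.3. OPEN CONJECTURE — [status: open].
[cite: GrossLMS1991, §1 Conj. 1.2 and Thm. 1.3 (p. 237)]
[cite: McCallumLMS1991, §5 Cor. 5.6 and Thm. 5.8 (pp. 314–315)]
[cite: GrossZagier1986, V.(2.2)] -/
@[conjecture] def HeegnerIndexBSDAt (W : WeierstrassCurve ℚ) [W.IsElliptic] [W.IsGloballyMinimal]
    (p : ℕ) [Fact p.Prime] : Prop :=
  p ≠ 2 → W.HasSurjectiveModNGaloisRep p →
  ∀ {N : ℕ} [NeZero N] (D : ModularParametrizationData W N)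
    (K : Type) [Field K] [NumberField K], IsImaginaryQuadratic K → SatisfiesHeegnerHypothesis N K →
    NumberField.discr K < -4 →
  ∀ (H : HeegnerDatum N (NumberField.discr K)) (ι : K →+* ℂ) (P : (W.baseChange K).toAffine.Point),
    WeierstrassCurve.Affine.Point.map ι.toRatAlgHom P = heegnerPointComplex D H →
    ¬ IsOfFinAddOrder P →
    padicValNat p (Nat.card (AddCommGroup.primaryComponent (W.baseChange K).sha p)) +
        2 * padicValNat p W.tamagawaProduct + 2 * padicValInt p D.maninConstant =
      2 * padicValNat p (AddSubgroup.zmultiples P).index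

/-! ## §2 The class conjectures at `p = 3` (nothing asserted) -/

/-- **Target T-O5-B: `O5HeegnerIndexThree` — Gross's Conjecture 1.2 holds `3`-adically on the TAME
POTENTIALLY GOOD ADDITIVE-`3` class under `3`-adic tower surjectivity**: for every `E/ℚ` additive at
`3` (`Addv W 3`), not potentially multiplicative (`v₃(j) ≥ 0`), with `f₃(E) = 2`
(`Additive.CondExpTwo W 3`), and `ρ̄_{E,3^n}` onto for all `n`: `HeegnerIndexBSDAt W 3`. The class
CONTAINS O5 (cells (t′) `e = 4` and (G)∧ss `e = 2`) and also the (G-ord) `e = 2` rows — the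
Heegner–Kolyvagin mechanism does not distinguish ordinary from supersingular potential reduction, so
no supersingularity binder is typed (honest superset; the census test is run on the O5 rows).
Printed antecedents: Kolyvagin's conjecture `M_∞ < ∞` and its refinement `M_∞ = ord_p(c ∏ c_q)`
(W. Zhang, CDM 2013 Conj. 4.3 / 4.5, stated for `ρ̄_{E,p}` onto, any reduction) — PROVED only at good
ordinary `p ≥ 5` (Zhang 2014 Thm. 1.1, 10.2) and good `p > 3` (Burungale–Castella–Grossi–Skinner
2023 Thm. 2); nothing in print at an additive `p`. OPEN CONJECTURE — [status: open].
[cite: GrossLMS1991, §1 Conj. 1.2 (p. 237)] [cite: McCallumLMS1991, §5 Thm. 5.8 (p. 315)] -/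
@[conjecture] def O5HeegnerIndexThree : Prop :=
  ∀ (W : WeierstrassCurve ℚ) [W.IsElliptic] [W.IsGloballyMinimal],
    Addv W 3 → 0 ≤ padicValRat 3 W.j → Additive.CondExpTwo W 3 →
    (∀ n : ℕ, W.HasSurjectiveModNGaloisRep (3 ^ n : ℕ)) → HeegnerIndexBSDAt W 3

/-- **`O6HeegnerIndexThree` — the WILD sibling (team O6: `v₃(N) ∈ {3,4,5}`, potentially good,
automatically potentially supersingular)**: the same conclusion on `Addv W 3 ∧ v₃(j) ≥ 0 ∧ f₃(E) ≠ 2`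
under tower surjectivity. Same antecedents; the only extra printed caveat is the Manin constant at
`v₃(N) ≥ 3` (Česnavičius–Neururer–Saha 2019 Thm. 1.2 allows `v₃(c) ≤ v₃(deg φ) + 1` there), which the
predicate carries explicitly as `ord₃ c_D`. OPEN CONJECTURE — [status: open].
[cite: GrossLMS1991, §1 Conj. 1.2 (p. 237)] [cite: McCallumLMS1991, §5 Thm. 5.8 (p. 315)] -/
@[conjecture] def O6HeegnerIndexThree : Prop :=
  ∀ (W : WeierstrassCurve ℚ) [W.IsElliptic] [W.IsGloballyMinimal],
    Addv W 3 → 0 ≤ padicValRat 3 W.j → ¬ Additive.CondExpTwo W 3 →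
    (∀ n : ℕ, W.HasSurjectiveModNGaloisRep (3 ^ n : ℕ)) → HeegnerIndexBSDAt W 3

/-- **`HeegnerIndexThree` — the umbrella: Gross's Conjecture 1.2 holds `3`-adically for EVERY `E/ℚ`
with `ρ̄_{E,3^n}` onto for all `n`** (no reduction binder, as Zhang CDM 2013 Conj. 4.5 is printed).
OPEN CONJECTURE — [status: open]. [cite: GrossLMS1991, §1 Conj. 1.2 (p. 237)] -/
@[conjecture] def HeegnerIndexThree : Prop :=
  ∀ (W : WeierstrassCurve ℚ) [W.IsElliptic] [W.IsGloballyMinimal],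
    (∀ n : ℕ, W.HasSurjectiveModNGaloisRep (3 ^ n : ℕ)) → HeegnerIndexBSDAt W 3

/-- `HeegnerIndexThree ⇒ O5HeegnerIndexThree` (restriction to the tame potentially good additive
rows). Bookkeeping. [folklore] -/
theorem o5HeegnerIndexThree_of_heegnerIndexThree (h : HeegnerIndexThree) : O5HeegnerIndexThree :=
  fun W _ _ _ _ _ hs => h W hs

/-- `HeegnerIndexThree ⇒ O6HeegnerIndexThree` (restriction to the wild potentially good additive
rows). Bookkeeping. [folklore] -/
theorem o6HeegnerIndexThree_of_heegnerIndexThree (h : HeegnerIndexThree) : O6HeegnerIndexThree :=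
  fun W _ _ _ _ _ hs => h W hs


/-! ## §3 The transport law in the kernel (theorems; every published input an explicit hypothesis)

Per pair, `HeegnerIndexBSDAt W p` and the odd-part splitting of `Ш(E/K)` give ONE linear identity
between `ord_p #Ш(E)`, `ord_p #Ш(E^K)`, the index, the Tamagawa product and `c_D`; Gross–Zagier in
the census currency (STEP-0, certified numerically per pair: `hstep0`) gives the same identity for
the analytic orders; so an UPPER half for one member is a LOWER half for the other and conversely,
and `BSD(·,p)`-exactness transfers across the pair. -/

/-- **The pair identity in Miller's currency.** Granted Gross–Zagier–Kolyvagin (`hGZK`, both members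
of analytic rank `≤ 1`, so both `Ш` finite) and `HeegnerIndexBSDAt W p` (`h`): for a Heegner pair as
in the predicate and a `ℚ`-model `Wd` of `E^{(d_K)}`,
`ord_p #Ш(E) + ord_p #Ш(E^K) + 2 ord_p ∏ c_q + 2 ord_p c_D = 2 ord_p [E(K) : ℤ P]`
(odd-part splitting: tree theorem `card_primaryComponent_sha_baseChange_quadratic_of_odd_of_finite`).
[cite: GrossLMS1991, §1 Conj. 1.2 (p. 237)] [cite: JetchevSkinnerWan2017, §7.4.1 (p. 30)] -/
theorem padicValNat_shaOrder_add_twist_eq_of_heegnerIndexBSDAt {N : ℕ} [NeZero N]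
    (hGZK : rank_eq_analyticRank_of_analyticRank_le_one)
    (W : WeierstrassCurve ℚ) [W.IsElliptic] [W.IsGloballyMinimal] (hr : W.analyticRank ≤ 1)
    (p : ℕ) [Fact p.Prime] (hp : p ≠ 2) (h : HeegnerIndexBSDAt W p)
    (hρ : W.HasSurjectiveModNGaloisRep p) (D : ModularParametrizationData W N)
    (K : Type) [Field K] [NumberField K] (hK : IsImaginaryQuadratic K)
    (hH : SatisfiesHeegnerHypothesis N K) (hdK : NumberField.discr K < -4)
    (H : HeegnerDatum N (NumberField.discr K)) (ι : K →+* ℂ) {P : (W.baseChange K).toAffine.Point}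
    (hP : WeierstrassCurve.Affine.Point.map ι.toRatAlgHom P = heegnerPointComplex D H)
    (hnt : ¬ IsOfFinAddOrder P)
    (Wd : WeierstrassCurve ℚ) [Wd.IsElliptic]
    (hWd : ∃ C : VariableChange ℚ, C • W.quadraticTwist (NumberField.discr K : ℚ) = Wd)
    (hrD : Wd.analyticRank ≤ 1) :
    padicValNat p W.shaOrder + padicValNat p Wd.shaOrder +
        2 * padicValNat p W.tamagawaProduct + 2 * padicValInt p D.maninConstant =
      2 * padicValNat p (AddSubgroup.zmultiples P).index := by
  haveI : Finite W.sha := (hGZK W hr).2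
  haveI : Finite Wd.sha := (hGZK Wd hrD).2
  haveI : Finite (AddCommGroup.primaryComponent W.sha p) :=
    Finite.of_injective _ Subtype.val_injective
  haveI : Finite (AddCommGroup.primaryComponent Wd.sha p) :=
    Finite.of_injective _ Subtype.val_injective
  have hKid := h hp hρ D K hK hH hdK H ι P hP hnt
  haveI : (W.baseChange K).IsElliptic := by rw [WeierstrassCurve.baseChange]; infer_instance
  have hprod := W.card_primaryComponent_sha_baseChange_quadratic_of_odd_of_finite K hK.1 Wd hWd
    (W.baseChange K) ⟨1, one_smul _ _⟩ p hp
  have ha : Nat.card (AddCommGroup.primaryComponent W.sha p) ≠ 0 := Nat.card_pos.ne'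
  have hb : Nat.card (AddCommGroup.primaryComponent Wd.sha p) ≠ 0 := Nat.card_pos.ne'
  rw [hprod, padicValNat.mul ha hb, padicValNat_card_addPrimaryComponent (A := W.sha) p,
    padicValNat_card_addPrimaryComponent (A := Wd.sha) p] at hKid
  simpa [WeierstrassCurve.shaOrder] using hKid

/-- **Transport, upper ↦ lower.** From the pair identity (`hid`, e.g. the previous theorem), the
STEP-0 identity of the analytic orders (`hstep0`: Gross–Zagier in the census currency, certified per
pair) and the UPPER half for `W` (`ord_p #Ш(E) ≤ ord_p #Ш_an(E)`, e.g. Kato at a rank-`0` member):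
the LOWER half for the partner, `ord_p #Ш_an(E^K) ≤ ord_p #Ш(E^K)`. Linear bookkeeping.
[cite: Miller2011LMS, Def. 1.1 (arXiv:1010.2431 p. 3)] -/
theorem missingLowerBoundAt_twist_of_pairIdentity_of_upper (W Wd : WeierstrassCurve ℚ) (p : ℕ)
    {I T M : ℕ} (hid : padicValNat p W.shaOrder + padicValNat p Wd.shaOrder + 2 * T + 2 * M = 2 * I)
    {q₀ q₁ : ℚ} (hq₀ : shaAn W = (q₀ : ℂ)) (hq₁ : shaAn Wd = (q₁ : ℂ))
    (hstep0 : padicValRat p q₀ + padicValRat p q₁ + 2 * T + 2 * M = 2 * I)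
    (hup : MissingUpperBoundAt W p) : MissingLowerBoundAt Wd p := by
  obtain ⟨q, hq, hle⟩ := hup
  have hqq : q = q₀ := by exact_mod_cast hq.symm.trans hq₀
  subst hqq
  refine ⟨q₁, hq₁, ?_⟩
  have hid' : ((padicValNat p W.shaOrder : ℤ) + padicValNat p Wd.shaOrder + 2 * T + 2 * M = 2 * I) := by
    exact_mod_cast hid
  linarith

/-- **Transport, lower ↦ upper.** Symmetrically: the pair identity, STEP-0 and the LOWER half for
`W` give the UPPER half for the partner. [cite: Miller2011LMS, Def. 1.1 (arXiv:1010.2431 p. 3)] -/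
theorem missingUpperBoundAt_twist_of_pairIdentity_of_lower (W Wd : WeierstrassCurve ℚ) (p : ℕ)
    {I T M : ℕ} (hid : padicValNat p W.shaOrder + padicValNat p Wd.shaOrder + 2 * T + 2 * M = 2 * I)
    {q₀ q₁ : ℚ} (hq₀ : shaAn W = (q₀ : ℂ)) (hq₁ : shaAn Wd = (q₁ : ℂ))
    (hstep0 : padicValRat p q₀ + padicValRat p q₁ + 2 * T + 2 * M = 2 * I)
    (hlow : MissingLowerBoundAt W p) : MissingUpperBoundAt Wd p := by
  obtain ⟨q, hq, hle⟩ := hlow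
  have hqq : q = q₀ := by exact_mod_cast hq.symm.trans hq₀
  subst hqq
  refine ⟨q₁, hq₁, ?_⟩
  have hid' : ((padicValNat p W.shaOrder : ℤ) + padicValNat p Wd.shaOrder + 2 * T + 2 * M = 2 * I) := by
    exact_mod_cast hid
  linarith

/-- **`BSD(·,p)`-exactness transfers across a Heegner pair** (modulo the pair identity and STEP-0):
`MissingPPartAt W p → MissingPPartAt Wd p`. This is the kernel form of "the rank-`1` cells of O5 need
no separate rank-`1` object": a rank-`0` theorem for `E^K` plus T-O5-B gives the rank-`1` member.
[cite: Miller2011LMS, Def. 1.1 (arXiv:1010.2431 p. 3)] -/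
theorem missingPPartAt_twist_of_pairIdentity (W Wd : WeierstrassCurve ℚ) (p : ℕ)
    {I T M : ℕ} (hid : padicValNat p W.shaOrder + padicValNat p Wd.shaOrder + 2 * T + 2 * M = 2 * I)
    {q₀ q₁ : ℚ} (hq₀ : shaAn W = (q₀ : ℂ)) (hq₁ : shaAn Wd = (q₁ : ℂ))
    (hstep0 : padicValRat p q₀ + padicValRat p q₁ + 2 * T + 2 * M = 2 * I)
    (hW : MissingPPartAt W p) : MissingPPartAt Wd p := by
  obtain ⟨hlow, hup⟩ := lower_and_upper_of_missingPPartAt W p hW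
  exact missingPPartAt_of_lower_of_upper Wd p
    (missingLowerBoundAt_twist_of_pairIdentity_of_upper W Wd p hid hq₀ hq₁ hstep0 hup)
    (missingUpperBoundAt_twist_of_pairIdentity_of_lower W Wd p hid hq₀ hq₁ hstep0 hlow)

end Summit.BirchSwinnertonDyer.Rank1Residual.O5

end
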